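import Mathlib
import Summits.MatrixMultiplication.MatrixMultiplication.Theorems.HiddenToeplitzCornersHiddenCornerLemmaRToeplitzThreeSlot
import Summits.MatrixMultiplication.MatrixMultiplication.Theorems.HiddenToeplitzCornersHiddenCornerLemmaRMixedNF1

/-!
# Mixed law `(p,q) = (1,1)`, normal form II: the cut, deep rows of `F`, high rows of `E`, low corner

Support file for crux item `stmt-MatrixMultiplication-10752`
(`Summit.MatrixMultiplication.MatrixMultiplication.Theses.HiddenToeplitzCorners.HiddenCornerLemmaR`),
line `frobenius-dual-short-syzygies`, stub `stub_mixedLaw`, sub-case `(p,q) = (1,1)`.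

In the normal form `∇M = e_γ ⊗ h + k ⊗ e_ω` (entry formula `hclR_nf_entry`), with `M` a
nonsingular member of the pencil:

* `hclR_nf_mulVec_low` — `M x` is supported on the middle rows `[γ, γ+ω)` when `x` is supported
  on rows `< ω`;
* `hclR_nf_cut_le` — nonsingularity forces `γ + ω ≤ N` (the `ω` low columns live on `N - γ` rows);
* `hclR_nf_low_of_mid` — if `M x` is supported on the middle rows then `x` is supported on rows
  `< ω` (the middle `ω × ω` block of `M` on low vectors is injective, hence surjective);
* `hclR_nf_F_deep` — in a corner with `3 ≤ r` whose frame vanishes on rows `[ω, ω+γ)`, the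
  targets vanish on the deep rows `≥ γ + ω`: those rows of the corner form an honest Toeplitz
  three-slot configuration, killed by `hclR_toeplitz_three_slot`;
* `hclR_nf_low_bound` — with `γ + ω ≤ N`, a corner whose frame is supported on the rows `< ω`
  and whose targets are supported on the rows `≥ γ` has `r ≤ 1`: rows `[γ, γ+ω)` of the corner
  read `corr(h a b, E_c) = [b = c] · f_a` (`corr(v, e)_i = ∑_m v m · e (m + i)`), and the valuation
  argument of `hclR_gconst_d_one` excludes two frame columns (no nonsingularity needed).
-/

set_option linter.dupNamespace false

namespace Summit.MatrixMultiplication.MatrixMultiplication.Theorems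

open Matrix BigOperators Finset

/-- Reindex a sum over `Fin N` whose low terms (indices `< a`) vanish. -/
theorem hclR_nf_sum_high {N a n : ℕ} (hN : a + n = N) (g : Fin N → ℂ)
    (hg : ∀ m : Fin N, (m : ℕ) < a → g m = 0) :
    ∑ m : Fin N, g m = ∑ j : Fin n, g ⟨a + j, by omega⟩ := by
  subst hN
  rw [Fin.sum_univ_add, Finset.sum_eq_zero fun i _ => hg _ (by simp), zero_add]
  rfl

/-- Reindex a sum over `Fin N` whose high terms (indices `≥ n`) vanish. -/
theorem hclR_nf_sum_low {N n : ℕ} (hn : n ≤ N) (g : Fin N → ℂ)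
    (hg : ∀ m : Fin N, n ≤ (m : ℕ) → g m = 0) :
    ∑ m : Fin N, g m = ∑ j : Fin n, g ⟨j, by omega⟩ := by
  obtain ⟨d, rfl⟩ : ∃ d, N = n + d := ⟨N - n, by omega⟩
  rw [Fin.sum_univ_add, Finset.sum_eq_zero fun (i : Fin d) _ => hg _ (by simp), add_zero]
  rfl

/-- **Low vectors go to the middle rows.**  If `x` is supported on rows `< ω` then `M x` vanishes
outside the rows `[γ, γ + ω)`. -/
theorem hclR_nf_mulVec_low {N : ℕ} (γ ω : ℕ) (M : Matrix (Fin N) (Fin N) ℂ) (η κ : Fin N → ℂ)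
    (hMent : ∀ n m : Fin N, M n m =
      (if hc : γ ≤ (n : ℕ) ∧ (n : ℕ) ≤ (m : ℕ) + γ then η ⟨(m : ℕ) + γ - n, by omega⟩ else 0) +
      (if hc : ω ≤ (m : ℕ) ∧ (m : ℕ) ≤ (n : ℕ) + ω then κ ⟨(n : ℕ) + ω - m, by omega⟩ else 0))
    (x : Fin N → ℂ) (hx : ∀ m : Fin N, ω ≤ (m : ℕ) → x m = 0)
    (n : Fin N) (hn : (n : ℕ) < γ ∨ γ + ω ≤ (n : ℕ)) : (M *ᵥ x) n = 0 := by
  simp only [Matrix.mulVec, dotProduct]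
  refine Finset.sum_eq_zero fun m _ => ?_
  by_cases hm : ω ≤ (m : ℕ)
  · rw [hx m hm, mul_zero]
  · rw [hMent, dif_neg (by omega), dif_neg (by omega), add_zero, zero_mul]

/-- **The cut fits.**  If `γ ≤ N`, `ω ≤ N` and `M` is injective then `γ + ω ≤ N`
(the `ω` columns `< ω` of `M` are supported on the `N - γ` rows `≥ γ`). -/
theorem hclR_nf_cut_le {N : ℕ} (γ ω : ℕ) (M : Matrix (Fin N) (Fin N) ℂ) (η κ : Fin N → ℂ)
    (hMent : ∀ n m : Fin N, M n m =
      (if hc : γ ≤ (n : ℕ) ∧ (n : ℕ) ≤ (m : ℕ) + γ then η ⟨(m : ℕ) + γ - n, by omega⟩ else 0) +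
      (if hc : ω ≤ (m : ℕ) ∧ (m : ℕ) ≤ (n : ℕ) + ω then κ ⟨(n : ℕ) + ω - m, by omega⟩ else 0))
    (hγ : γ ≤ N) (hω : ω ≤ N) (hinj : Function.Injective M.mulVec) : γ + ω ≤ N := by
  by_contra hlt
  push Not at hlt
  let Msub : Matrix (Fin (N - γ)) (Fin ω) ℂ := Matrix.of fun i j => M ⟨γ + i, by omega⟩ ⟨j, by omega⟩
  have hker : LinearMap.ker Msub.mulVecLin ≠ ⊥ := by
    apply LinearMap.ker_ne_bot_of_finrank_lt
    simp only [Module.finrank_fin_fun]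
    omega
  obtain ⟨z, hz, hz0⟩ : ∃ z ∈ LinearMap.ker Msub.mulVecLin, z ≠ 0 := Submodule.exists_mem_ne_zero_of_ne_bot hker
  rw [LinearMap.mem_ker, Matrix.mulVecLin_apply] at hz
  let x : Fin N → ℂ := fun m => if h : (m : ℕ) < ω then z ⟨m, h⟩ else 0
  have hxlow : ∀ m : Fin N, ω ≤ (m : ℕ) → x m = 0 := fun m hm => by simp only [x, dif_neg (not_lt.mpr hm)]
  have hMx : M *ᵥ x = 0 := by
    funext n
    rcases lt_or_ge (n : ℕ) γ with hn | hn
    · exact hclR_nf_mulVec_low γ ω M η κ hMent x hxlow n (Or.inl hn)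
    · have e : (M *ᵥ x) n = (Msub *ᵥ z) ⟨(n : ℕ) - γ, by omega⟩ := by
        simp only [Matrix.mulVec, dotProduct]
        rw [hclR_nf_sum_low hω _ (fun m hm => by rw [hxlow m hm, mul_zero])]
        refine Finset.sum_congr rfl fun j _ => ?_
        simp only [Msub, x, Matrix.of_apply, dif_pos j.is_lt]
        congr 2; ext; simp only; omega
      rw [e, hz]; rfl
  apply hz0
  have hx0 : x = 0 := hinj (by rw [hMx, Matrix.mulVec_zero])
  funext j
  have := congr_fun hx0 ⟨j, by omega⟩
  simp only [x, dif_pos j.is_lt, Pi.zero_apply] at this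
  exact this

/-- **Middle image means low source.**  If `γ + ω ≤ N`, `M` is injective and `M x` vanishes outside
the middle rows `[γ, γ + ω)`, then `x` vanishes on rows `≥ ω`. -/
theorem hclR_nf_low_of_mid {N : ℕ} (γ ω : ℕ) (M : Matrix (Fin N) (Fin N) ℂ) (η κ : Fin N → ℂ)
    (hMent : ∀ n m : Fin N, M n m =
      (if hc : γ ≤ (n : ℕ) ∧ (n : ℕ) ≤ (m : ℕ) + γ then η ⟨(m : ℕ) + γ - n, by omega⟩ else 0) +
      (if hc : ω ≤ (m : ℕ) ∧ (m : ℕ) ≤ (n : ℕ) + ω then κ ⟨(n : ℕ) + ω - m, by omega⟩ else 0))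
    (hN : γ + ω ≤ N) (hinj : Function.Injective M.mulVec) (x : Fin N → ℂ)
    (hx : ∀ n : Fin N, (n : ℕ) < γ ∨ γ + ω ≤ (n : ℕ) → (M *ᵥ x) n = 0) :
    ∀ m : Fin N, ω ≤ (m : ℕ) → x m = 0 := by
  let Msq : Matrix (Fin ω) (Fin ω) ℂ := Matrix.of fun i j => M ⟨γ + i, by omega⟩ ⟨j, by omega⟩
  let pad : (Fin ω → ℂ) → (Fin N → ℂ) := fun z m => if h : (m : ℕ) < ω then z ⟨m, h⟩ else 0
  have hpadlow : ∀ z, ∀ m : Fin N, ω ≤ (m : ℕ) → pad z m = 0 := fun z m hm => by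
    simp only [pad, dif_neg (not_lt.mpr hm)]
  have hpadmid : ∀ z, ∀ n : Fin N, ∀ (h1 : γ ≤ (n : ℕ)) (h2 : (n : ℕ) < γ + ω),
      (M *ᵥ pad z) n = (Msq *ᵥ z) ⟨(n : ℕ) - γ, by omega⟩ := by
    intro z n h1 h2
    simp only [Matrix.mulVec, dotProduct]
    rw [hclR_nf_sum_low (show ω ≤ N by omega) _ (fun m hm => by rw [hpadlow z m hm, mul_zero])]
    refine Finset.sum_congr rfl fun j _ => ?_
    simp only [Msq, pad, Matrix.of_apply, dif_pos j.is_lt]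
    congr 2; ext; simp only; omega
  -- `Msq` is injective, hence surjective
  have hsqinj : Function.Injective Msq.mulVec := by
    intro z₁ z₂ hz
    have hM : M *ᵥ pad z₁ = M *ᵥ pad z₂ := by
      funext n
      rcases lt_or_ge (n : ℕ) γ with hn | hn
      · rw [hclR_nf_mulVec_low γ ω M η κ hMent _ (hpadlow z₁) n (Or.inl hn),
          hclR_nf_mulVec_low γ ω M η κ hMent _ (hpadlow z₂) n (Or.inl hn)]
      · rcases lt_or_ge (n : ℕ) (γ + ω) with hn2 | hn2
        · rw [hpadmid z₁ n hn hn2, hpadmid z₂ n hn hn2, hz]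
        · rw [hclR_nf_mulVec_low γ ω M η κ hMent _ (hpadlow z₁) n (Or.inr hn2),
            hclR_nf_mulVec_low γ ω M η κ hMent _ (hpadlow z₂) n (Or.inr hn2)]
    have hp := hinj hM
    funext j
    have := congr_fun hp ⟨j, by omega⟩
    simp only [pad, dif_pos j.is_lt] at this
    exact this
  have hsqsurj : Function.Surjective Msq.mulVec :=
    Matrix.mulVec_surjective_iff_isUnit.mpr (Matrix.mulVec_injective_iff_isUnit.mp hsqinj)
  obtain ⟨z, hz⟩ := hsqsurj fun i => (M *ᵥ x) ⟨γ + i, by omega⟩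
  have hM : M *ᵥ pad z = M *ᵥ x := by
    funext n
    rcases lt_or_ge (n : ℕ) γ with hn | hn
    · rw [hclR_nf_mulVec_low γ ω M η κ hMent _ (hpadlow z) n (Or.inl hn), hx n (Or.inl hn)]
    · rcases lt_or_ge (n : ℕ) (γ + ω) with hn2 | hn2
      · rw [hpadmid z n hn hn2, hz]
        dsimp only
        congr 1; ext; simp only; omega
      · rw [hclR_nf_mulVec_low γ ω M η κ hMent _ (hpadlow z) n (Or.inr hn2), hx n (Or.inr hn2)]
  have hp := hinj hM
  intro m hm
  rw [← hp]
  exact hpadlow z m hm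

/-- **Deep rows of `F`.**  In the `(1,1)` normal form with `γ + ω ≤ N`, a corner with `3 ≤ r` whose
frame vanishes on the rows `[ω, ω + γ)` has all targets vanishing on the rows `≥ γ + ω`: on those
rows the corner identity is an honest Toeplitz three-slot configuration on the deep parts of the
frame columns, and `hclR_toeplitz_three_slot` applies. -/
theorem hclR_nf_F_deep :
    ∀ (r N γ ω : ℕ) (T : Fin r → Fin r → Matrix (Fin N) (Fin N) ℂ)
      (E F : Matrix (Fin N) (Fin r) ℂ) (h k : Fin r → Fin r → Fin N → ℂ), 3 ≤ r → γ + ω ≤ N →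
      (∀ X : Matrix (Fin r) (Fin r) ℂ, (∑ a : Fin r, ∑ b : Fin r, X a b • T a b) * E = F * X) →
      (∀ a b, T a b - (Matrix.of fun i j : Fin N => if (i : ℕ) = (j : ℕ) + 1 then (1 : ℂ) else 0) *
          T a b * (Matrix.of fun i j : Fin N => if (i : ℕ) = (j : ℕ) + 1 then (1 : ℂ) else 0)ᵀ =
        Matrix.vecMulVec (fun i : Fin N => if (i : ℕ) = γ then (1 : ℂ) else 0) (h a b) +
          Matrix.vecMulVec (k a b) (fun j : Fin N => if (j : ℕ) = ω then (1 : ℂ) else 0)) →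
      (∀ (m : Fin N) (c : Fin r), ω ≤ (m : ℕ) → (m : ℕ) < ω + γ → E m c = 0) →
      ∀ (i : Fin N) (a : Fin r), γ + ω ≤ (i : ℕ) → F i a = 0 := by
  intro r N γ ω T E F h k hr hN hcorner hdisp hEmid i₀ a hi₀
  set d := N - (γ + ω) with hd
  have hent : ∀ a b, ∀ n m : Fin N, T a b n m =
      (if hc : γ ≤ (n : ℕ) ∧ (n : ℕ) ≤ (m : ℕ) + γ then h a b ⟨(m : ℕ) + γ - n, by omega⟩ else 0) +
      (if hc : ω ≤ (m : ℕ) ∧ (m : ℕ) ≤ (n : ℕ) + ω then k a b ⟨(n : ℕ) + ω - m, by omega⟩ else 0) :=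
    fun a b => hclR_nf_entry γ ω (T a b) (h a b) (k a b) (hdisp a b)
  -- the three slots and the deep blocks
  let β : Fin 3 → Fin r := fun s => ⟨(s : ℕ), by omega⟩
  have hβ : ∀ s t : Fin 3, β s = β t → s = t := by
    intro s t hst
    have := congrArg Fin.val hst
    exact Fin.ext this
  let Td : Fin 3 → Matrix (Fin d) (Fin d) ℂ := fun s =>
    Matrix.of fun i j => T a (β s) ⟨γ + ω + i, by omega⟩ ⟨γ + ω + j, by omega⟩
  let Ed : Fin 3 → Fin d → ℂ := fun s j => E ⟨γ + ω + j, by omega⟩ (β s)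
  let fd : Fin d → ℂ := fun i => F ⟨γ + ω + i, by omega⟩ a
  have htoep : ∀ s, ∀ i j i' j' : Fin d, (i : ℕ) + j' = i' + j → Td s i j = Td s i' j' := by
    intro s i j i' j' hsum
    simp only [Td, Matrix.of_apply]
    rw [hent, hent]
    congr 1
    · by_cases hc : (i : ℕ) ≤ γ + j
      · rw [dif_pos (by simp only; constructor <;> omega), dif_pos (by simp only; constructor <;> omega)]
        congr 1; ext; simp only; omega
      · rw [dif_neg (by simp only; omega), dif_neg (by simp only; omega)]
    · by_cases hc : (j : ℕ) ≤ ω + i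
      · rw [dif_pos (by simp only; constructor <;> omega), dif_pos (by simp only; constructor <;> omega)]
        congr 1; ext; simp only; omega
      · rw [dif_neg (by simp only; omega), dif_neg (by simp only; omega)]
  have hcd : ∀ s t, Td s *ᵥ Ed t = if s = t then fd else 0 := by
    intro s t
    have hcol := hclR_nf_corner_col T E F hcorner a (β s) (β t)
    funext i
    have e : (Td s *ᵥ Ed t) i = (T a (β s) *ᵥ fun m => E m (β t)) ⟨γ + ω + i, by omega⟩ := by
      simp only [Matrix.mulVec, dotProduct, Td, Ed, Matrix.of_apply]
      symm
      apply hclR_nf_sum_high (show (γ + ω) + d = N by omega)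
      intro m hm
      rcases lt_or_ge (m : ℕ) ω with hm2 | hm2
      · rw [hent, dif_neg (by simp only; omega), dif_neg (by omega), add_zero, zero_mul]
      · rw [hEmid m (β t) hm2 (by omega), mul_zero]
    rw [e, hcol]
    by_cases hst : s = t
    · subst hst; simp only [if_true]; rfl
    · rw [if_neg (fun h' => hst (hβ s t h')), if_neg hst]; rfl
  have hfd : fd = 0 := hclR_toeplitz_three_slot Td htoep Ed fd hcd
  have e : i₀ = ⟨γ + ω + ((i₀ : ℕ) - (γ + ω)), by omega⟩ := Fin.ext (by simp only; omega)
  have := congr_fun hfd ⟨(i₀ : ℕ) - (γ + ω), by omega⟩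
  simp only [fd, Pi.zero_apply] at this
  rw [e]
  exact this

/-- **The low corner.**  Normal form with `γ + ω ≤ N`, frame supported on rows `< ω`, targets
supported on rows `≥ γ`: then `r ≤ 1` (valuation argument; no nonsingularity needed). -/
theorem hclR_nf_low_bound (r N γ ω : ℕ) (T : Fin r → Fin r → Matrix (Fin N) (Fin N) ℂ)
    (E F : Matrix (Fin N) (Fin r) ℂ) (h k : Fin r → Fin r → Fin N → ℂ) (hN : γ + ω ≤ N)
    (hE : E.rank = r) (hF : F.rank = r)
    (hcorner : ∀ X : Matrix (Fin r) (Fin r) ℂ, (∑ a : Fin r, ∑ b : Fin r, X a b • T a b) * E = F * X)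
    (hdisp : ∀ a b, T a b - (Matrix.of fun i j : Fin N => if (i : ℕ) = (j : ℕ) + 1 then (1 : ℂ) else 0) *
        T a b * (Matrix.of fun i j : Fin N => if (i : ℕ) = (j : ℕ) + 1 then (1 : ℂ) else 0)ᵀ =
      Matrix.vecMulVec (fun i : Fin N => if (i : ℕ) = γ then (1 : ℂ) else 0) (h a b) +
        Matrix.vecMulVec (k a b) (fun j : Fin N => if (j : ℕ) = ω then (1 : ℂ) else 0))
    (hElow : ∀ (m : Fin N) (c : Fin r), ω ≤ (m : ℕ) → E m c = 0)
    (hFtop : ∀ (i : Fin N) (a : Fin r), (i : ℕ) < γ → F i a = 0) : r ≤ 1 := by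
  by_contra hr
  push Not at hr
  have hN0 : 0 < N := by
    rcases Nat.eq_zero_or_pos N with h0 | h0
    · subst h0
      have : E.rank ≤ 0 := by simpa using Matrix.rank_le_card_height E
      omega
    · exact h0
  have hent : ∀ a b, ∀ n m : Fin N, T a b n m =
      (if hc : γ ≤ (n : ℕ) ∧ (n : ℕ) ≤ (m : ℕ) + γ then h a b ⟨(m : ℕ) + γ - n, by omega⟩ else 0) +
      (if hc : ω ≤ (m : ℕ) ∧ (m : ℕ) ≤ (n : ℕ) + ω then k a b ⟨(n : ℕ) + ω - m, by omega⟩ else 0) :=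
    fun a b => hclR_nf_entry γ ω (T a b) (h a b) (k a b) (hdisp a b)
  -- a nonzero target column
  have hFne : ∃ a : Fin r, (fun i => F i a) ≠ 0 := by
    by_contra hall
    push Not at hall
    have : F = 0 := by
      ext i a; exact congr_fun (hall a) i
    rw [this, Matrix.rank_zero] at hF; omega
  obtain ⟨a₀, ha₀⟩ := hFne
  set f : Fin N → ℂ := fun i => if hi : γ + (i : ℕ) < N then F ⟨γ + i, hi⟩ a₀ else 0 with hfdef
  have hf : f ≠ 0 := by
    intro hf0
    apply ha₀
    funext n
    simp only [Pi.zero_apply]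
    rcases lt_or_ge (n : ℕ) γ with hn | hn
    · exact hFtop n a₀ hn
    · have := congr_fun hf0 ⟨(n : ℕ) - γ, by omega⟩
      simp only [hfdef, Pi.zero_apply, dif_pos (show γ + ((n : ℕ) - γ) < N by omega)] at this
      rw [← this]; congr 1; ext; simp only; omega
  -- every frame column is nonzero (adapted from `hclR_gconst_d_one`)
  have hEcol : ∀ c : Fin r, (fun i => E i c) ≠ 0 := by
    intro c hc
    have hker : (Pi.single c (1 : ℂ) : Fin r → ℂ) ∈ LinearMap.ker E.mulVecLin := by
      rw [LinearMap.mem_ker, Matrix.mulVecLin_apply]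
      ext i
      simp only [Matrix.mulVec, dotProduct, Pi.single_apply, mul_ite, mul_one, mul_zero,
        Finset.sum_ite_eq', Finset.mem_univ, if_true, Pi.zero_apply]
      exact congr_fun hc i
    have hk : 0 < Module.finrank ℂ (LinearMap.ker E.mulVecLin) := by
      apply Module.finrank_pos_iff_exists_ne_zero.mpr
      refine ⟨⟨Pi.single c 1, hker⟩, ?_⟩
      simp [Subtype.ext_iff]
    have hrn := LinearMap.finrank_range_add_finrank_ker E.mulVecLin
    have hrk : E.rank = Module.finrank ℂ (LinearMap.range E.mulVecLin) := rfl
    simp only [Module.finrank_fintype_fun_eq_card, Fintype.card_fin] at hrn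
    omega
  -- the correlation identity: rows `[γ, γ+ω)` of the corner
  have hcorr : ∀ (b c : Fin r) (i : Fin N),
      (∑ m : Fin N, h a₀ b m * (if hm : (m : ℕ) + (i : ℕ) < N then E ⟨(m : ℕ) + i, hm⟩ c else 0)) =
        if b = c then f i else 0 := by
    intro b c i
    by_cases hi : γ + (i : ℕ) < N
    · have hcol := congr_fun (hclR_nf_corner_col T E F hcorner a₀ b c) ⟨γ + i, hi⟩
      have hrhs : (if b = c then f i else 0) = (if b = c then (fun i => F i a₀) else 0) ⟨γ + i, hi⟩ := by
        split_ifs <;> simp [hfdef, dif_pos hi]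
      rw [hrhs, ← hcol]
      simp only [Matrix.mulVec, dotProduct]
      rw [hclR_nf_sum_low (show N - (i : ℕ) ≤ N by omega) _ (fun m hm => by
            rw [dif_neg (by omega), mul_zero]),
        hclR_nf_sum_high (show (i : ℕ) + (N - i) = N by omega) _ (fun m hm => by
            rcases lt_or_ge (m : ℕ) ω with hmω | hmω
            · rw [hent, dif_neg (by simp only; omega), dif_neg (by omega), add_zero, zero_mul]
            · rw [hElow m c hmω, mul_zero])]
      refine Finset.sum_congr rfl fun j _ => ?_
      rw [dif_pos (by simp only; omega)]
      rcases lt_or_ge ((i : ℕ) + j) ω with hij | hij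
      · rw [hent, dif_pos (by simp only; constructor <;> omega), dif_neg (by simp only; omega), add_zero]
        congr 1
        · congr 1; ext; simp only; omega
        · congr 1; ext; simp only; omega
      · rw [hElow _ c (by simp only; omega), hElow _ c (by simp only; omega), mul_zero, mul_zero]
    · have hrhs : (if b = c then f i else 0) = 0 := by
        split_ifs <;> simp [hfdef, dif_neg hi]
      rw [hrhs]
      refine Finset.sum_eq_zero fun m _ => ?_
      by_cases hm : (m : ℕ) + (i : ℕ) < N
      · rw [dif_pos hm, hElow _ c (by simp only; omega), mul_zero]
      · rw [dif_neg hm, mul_zero]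
  -- valuation argument (as in `hclR_gconst_d_one`)
  set b₁ : Fin r := ⟨0, by omega⟩ with hb₁
  set b₂ : Fin r := ⟨1, by omega⟩ with hb₂
  have hb12 : b₁ ≠ b₂ := by simp [hb₁, hb₂, Fin.ext_iff]
  have hvne : ∀ b : Fin r, ∃ m : Fin N, h a₀ b m ≠ 0 := by
    intro b
    by_contra hall; push Not at hall
    apply hf
    funext i
    have := hcorr b b i
    rw [if_pos rfl] at this
    rw [← this]
    exact Finset.sum_eq_zero fun m _ => by rw [hall m, zero_mul]
  have key : ∀ b c : Fin r, ∀ ν δ : Fin N, h a₀ b ν ≠ 0 → (∀ m, h a₀ b m ≠ 0 → (ν : ℕ) ≤ m) →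
      E δ c ≠ 0 → (∀ i, E i c ≠ 0 → (i : ℕ) ≤ δ) →
      (b ≠ c → (δ : ℕ) < ν) ∧ (b = c → (ν : ℕ) ≤ δ) := by
    intro b c ν δ hvν hvmin hEδ hEmax
    constructor
    · intro hbc
      by_contra hle; push Not at hle
      have hz := hcorr b c ⟨(δ : ℕ) - ν, by omega⟩
      rw [if_neg hbc] at hz
      exact hclR_corr_ne_zero_at (h a₀ b) (fun i => E i c) ν δ hvν hvmin hEδ hEmax hle hz
    · intro hbc
      subst hbc
      by_contra hlt; push Not at hlt
      apply hf
      funext i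
      have hz := hcorr b b i
      rw [if_pos rfl] at hz
      rw [← hz]
      exact hclR_corr_eq_zero_of_lt (h a₀ b) (fun i => E i b) ν δ hvmin hEmax hlt i
  have hmin : ∀ b : Fin r, ∃ ν : Fin N, h a₀ b ν ≠ 0 ∧ ∀ m, h a₀ b m ≠ 0 → (ν : ℕ) ≤ m := by
    intro b
    obtain ⟨m0, hm0⟩ := hvne b
    obtain ⟨ν, hν, hmin⟩ := (Finset.univ.filter fun m : Fin N => h a₀ b m ≠ 0).exists_min_image
      (fun m => (m : ℕ)) ⟨m0, by simp [hm0]⟩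
    exact ⟨ν, (Finset.mem_filter.mp hν).2, fun m hm => hmin m (by simp [hm])⟩
  have hmax : ∀ c : Fin r, ∃ δ : Fin N, E δ c ≠ 0 ∧ ∀ i, E i c ≠ 0 → (i : ℕ) ≤ δ := by
    intro c
    have : ∃ i0 : Fin N, E i0 c ≠ 0 := by
      by_contra hall; push Not at hall
      exact hEcol c (funext hall)
    obtain ⟨i0, hi0⟩ := this
    obtain ⟨δ, hδ, hmax⟩ := (Finset.univ.filter fun i : Fin N => E i c ≠ 0).exists_max_image
      (fun i => (i : ℕ)) ⟨i0, by simp [hi0]⟩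
    exact ⟨δ, (Finset.mem_filter.mp hδ).2, fun i hi => hmax i (by simp [hi])⟩
  obtain ⟨ν₁, hν₁, hν₁min⟩ := hmin b₁
  obtain ⟨ν₂, hν₂, hν₂min⟩ := hmin b₂
  obtain ⟨δ₁, hδ₁, hδ₁max⟩ := hmax b₁
  obtain ⟨δ₂, hδ₂, hδ₂max⟩ := hmax b₂
  have h11 := (key b₁ b₁ ν₁ δ₁ hν₁ hν₁min hδ₁ hδ₁max).2 rfl
  have h12 := (key b₁ b₂ ν₁ δ₂ hν₁ hν₁min hδ₂ hδ₂max).1 hb12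
  have h22 := (key b₂ b₂ ν₂ δ₂ hν₂ hν₂min hδ₂ hδ₂max).2 rfl
  have h21 := (key b₂ b₁ ν₂ δ₁ hν₂ hν₂min hδ₁ hδ₁max).1 hb12.symm
  omega


end Summit.MatrixMultiplication.MatrixMultiplication.Theorems
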